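import Literature.Computability.QuantumComplexity.OneCleanQubitPolarization
import Literature.Computability.QuantumComplexity.OneQubitReflections
import Literature.Computability.Complexity.BranchingFn
import HarnessLib

/-!
# The one-clean-qubit model, III: `P ⊆ DQC1`

Topic `Literature/Computability/QuantumComplexity`; sequel to `OneCleanQubit.lean` (`IsDQC1Decidable`,
`DQC1`) and `OneCleanQubitPolarization.lean` (`oneCleanQubitAcceptProb`, `mem_DQC1_iff'`), closing
the API point of the definition request `defn-OneCleanQubit`: "P ⊆ DQC1 natively (the FP
generator decides `x` and flips wire 0)".

Shor–Jordan 2008, §1 (arXiv p. 3): "In the original definition [Knill–Laflamme] of DQC1 it is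
assumed that a classical computer generates the quantum circuits to be applied to the initial
state `ρ`. By this definition DQC1 automatically contains the complexity class P." Formally
(`P_subset_DQC1`): for `L ∈ P` the generator uses no mixed wire (`k x = 0`) and outputs, on the
single clean wire, the Clifford+T word `X = H S S H` (`xWordCirc`, acceptance probability `1`,
`oneCleanQubitAcceptProb_xWordCirc`) if `x ∈ L` and the empty circuit (acceptance probability `0`,
`oneCleanQubitAcceptProb_nil`) otherwise; the description map is `FP` because it is a case
distinction on the `FP` indicator of `L ∈ P` between two constants (`indicatorFn_mem_FP`,
`iteFn_mem_FP`, `const_mem_FP` of the Complexity toolkit); the bias polynomial is `q = 1`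
(thresholds `1/2 ± 1/2`). Everything is proved; no definition of a class and no named fact is
introduced (`xWordCirc` is a concrete circuit).

## References

* P. W. Shor, S. P. Jordan, *Estimating Jones polynomials is a complete problem for one clean
  qubit*, Quantum Inf. Comput. 8 (2008) 681–714, arXiv:0707.2831, §1 p. 3. [ShorJordan2008]
* E. Knill, R. Laflamme, *Power of one bit of quantum information*, Phys. Rev. Lett. 81 (1998)
  5672–5675, p. 2 ("The first uses the classical computer to generate a sequence of unitary
  operations"). [KnillLaflamme1998]
* M. A. Nielsen, I. L. Chuang, *Quantum Computation and Quantum Information*, CUP 2010, §4.2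
  (`S² = Z`, `HZH = X`, Ex. 4.18). [NielsenChuang2010]
-/

noncomputable section

namespace Literature.Computability.QuantumComplexity

open _root_.Computability Complexity Cryptography OneQubit

/-! ### The bit flip on the clean wire as a Clifford+T word -/

/-- Placing a one-qubit gate along the identity embedding does nothing (local copy of the
five-line `placeGate_refl` of `QuantumTuringADHRealGateSet.lean`, not imported for its weight). [folklore] -/
private theorem placeGate_refl_one (U : Matrix (QReg 1) (QReg 1) ℂ) :
    placeGate (Function.Embedding.refl (Fin 1)) U = U := by
  ext x y
  rw [placeGate_apply, if_pos]
  · rfl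
  · intro i hi
    exact absurd ⟨i, rfl⟩ hi

/-- The one-wire Clifford+T circuit `H; S; S; H`, i.e. the bit flip `X = H S² H = H Z H` on the
clean wire. (Nielsen–Chuang 2010, §4.2, Ex. 4.18.) [cite: NielsenChuang2010, §4.2 Ex. 4.18] -/
def xWordCirc : QCircuit cliffordT 1 :=
  ⟨[QGate.gate CliffordTOp.H (Function.Embedding.refl (Fin 1)),
    QGate.gate CliffordTOp.S (Function.Embedding.refl (Fin 1)),
    QGate.gate CliffordTOp.S (Function.Embedding.refl (Fin 1)),
    QGate.gate CliffordTOp.H (Function.Embedding.refl (Fin 1))]⟩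

/-- `xWordCirc` is oracle-free (four gate symbols). [folklore] -/
theorem xWordCirc_isOracleFree : xWordCirc.IsOracleFree := by
  intro g hg
  simp only [xWordCirc, List.mem_cons, List.not_mem_nil, or_false] at hg
  rcases hg with rfl | rfl | rfl | rfl <;> exact trivial

/-- `S = diag(1, i)` by entries. (Nielsen–Chuang 2010, §4.2.) [cite: NielsenChuang2010, §4.2] -/
theorem sGate_eq_m2 : sGate = m2 1 0 0 Complex.I := by
  ext x y
  obtain rfl | rfl := eq_q0_or_eq_q1 x <;> obtain rfl | rfl := eq_q0_or_eq_q1 y <;>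
    simp [sGate, m2_apply, q0_ne_q1, q0_ne_q1.symm]

/-- `S² = Z`. (Nielsen–Chuang 2010, §4.2.) [cite: NielsenChuang2010, §4.2] -/
theorem sGate_mul_sGate : sGate * sGate = pauliZ := by
  rw [sGate_eq_m2, pauliZ_eq_m2, m2_mul_m2, m2_inj]
  refine ⟨by ring, by ring, by ring, ?_⟩
  rw [Complex.I_mul_I]
  ring

/-- **The word `H S S H` computes `X`** (for every oracle: it has no oracle gate).
[cite: NielsenChuang2010, §4.2 Ex. 4.18] -/
theorem toMatrix_xWordCirc (A : Language Bool) : xWordCirc.toMatrix A = pauliX := by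
  rw [xWordCirc, QCircuit.toMatrix_cons, QCircuit.toMatrix_cons, QCircuit.toMatrix_cons,
    QCircuit.toMatrix_cons, QCircuit.toMatrix_nil, one_mul]
  change placeGate (Function.Embedding.refl (Fin 1)) hGate *
      placeGate (Function.Embedding.refl (Fin 1)) sGate *
      placeGate (Function.Embedding.refl (Fin 1)) sGate *
      placeGate (Function.Embedding.refl (Fin 1)) hGate = pauliX
  rw [placeGate_refl_one, placeGate_refl_one, mul_assoc hGate, sGate_mul_sGate,
    hGate_mul_pauliZ_mul_hGate]

/-- On the input `|0⟩` the word `H S S H` outputs `|1⟩` with certainty: the Born probability of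
"wire `0` reads `1`" is `|X₁₀|² = 1`. [folklore] -/
theorem probEvent_xWordCirc_q0 :
    xWordCirc.probEvent 0 (basisState q0) (QCircuit.acceptEvent 1) = 1 := by
  classical
  simp only [QCircuit.probEvent, runOn_basisState_apply, toMatrix_xWordCirc, Finset.sum_filter]
  rw [sum_qReg_one]
  have h1 : q1 ∈ QCircuit.acceptEvent 1 := ⟨Nat.one_pos, rfl⟩
  have h0 : q0 ∉ QCircuit.acceptEvent 1 := fun ⟨_, h⟩ => Bool.false_ne_true h
  rw [if_neg h0, if_pos h1, zero_add]
  simp [pauliX]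

/-! ### Acceptance probabilities with no mixed wire -/

/-- With no register wires the input label `|b⟩|·⟩` is the one-wire label `b`. [folklore] -/
theorem append_qReg_zero (b : Bool) (r : QReg 0) :
    Fin.append (fun _ : Fin 1 => b) r = fun _ : Fin 1 => b := by
  funext i
  rw [show i = ⟨0, by omega⟩ from Fin.ext (by have := i.2; omega)]
  exact append_apply_zero b r _

/-- The flip word accepts with probability `1` in the one-clean-qubit model with `k = 0`. [folklore] -/
theorem oneCleanQubitAcceptProb_xWordCirc : oneCleanQubitAcceptProb (k := 0) xWordCirc = 1 := by
  unfold oneCleanQubitAcceptProb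
  rw [Fintype.sum_unique]
  simp only [append_qReg_zero, pow_zero, div_one, one_mul]
  exact probEvent_xWordCirc_q0

/-- The empty circuit accepts with probability `0` in the one-clean-qubit model with `k = 0`
(the clean wire stays `|0⟩`). [folklore] -/
theorem oneCleanQubitAcceptProb_nil :
    oneCleanQubitAcceptProb (k := 0) (⟨[]⟩ : QCircuit cliffordT (1 + 0)) = 0 := by
  classical
  unfold oneCleanQubitAcceptProb
  simp only [QCircuit.probEvent, runOn_basisState_apply, QCircuit.toMatrix_nil, Finset.sum_filter]
  refine Finset.sum_eq_zero fun r _ => mul_eq_zero_of_right _ (Finset.sum_eq_zero fun y _ => ?_)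
  by_cases hy : y ∈ QCircuit.acceptEvent (1 + 0)
  · rw [if_pos hy, Matrix.one_apply_ne, norm_zero]
    · simp
    · rintro rfl
      obtain ⟨h, hb⟩ := hy
      rw [append_apply_zero] at hb
      exact Bool.false_ne_true hb
  · rw [if_neg hy]

/-! ### `P ⊆ DQC1` -/

/-- **`P ⊆ DQC1`** (Shor–Jordan 2008, §1, p. 3: "In the original definition [Knill–Laflamme] of
DQC1 it is assumed that a classical computer generates the quantum circuits … By this definition
DQC1 automatically contains the complexity class P"). For `L ∈ P` take no mixed wire and let the
`FP` generator output the word `H S S H` (accept with probability `1`) on `x ∈ L` and the empty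
circuit (probability `0`) on `x ∉ L` — a case distinction on the poly-time indicator of `L` between
two constant descriptions; bias polynomial `q = 1`. [cite: ShorJordan2008, §1 p. 3] -/
theorem P_subset_DQC1 : Classes.P ⊆ DQC1 := by
  intro L hL
  rw [mem_DQC1_iff']
  refine ⟨fun _ => 0, fun x => if L.boolIndicator x then xWordCirc else ⟨[]⟩, ?_, ?_, 1, fun x => ?_⟩
  · -- oracle-free
    intro x
    dsimp only
    split
    · exact xWordCirc_isOracleFree
    · intro g hg
      simp at hg
  · -- the description map is a poly-time case distinction between two constants
    have hc := indicatorFn_mem_FP hL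
    have key : (fun x : List Bool => QCircuit.sigmaEncode (G := cliffordT)
          ⟨1, 0, if L.boolIndicator x then xWordCirc else ⟨[]⟩⟩) =
        iteFn (fun x => encodeBool (L.boolIndicator x))
          (fun _ => QCircuit.sigmaEncode (G := cliffordT) ⟨1, 0, xWordCirc⟩)
          (fun _ => QCircuit.sigmaEncode (G := cliffordT) ⟨1, 0, (⟨[]⟩ : QCircuit cliffordT 1)⟩) := by
      funext x
      have h : (fun x => encodeBool (L.boolIndicator x)) x = [L.boolIndicator x] := rfl
      rw [iteFn_apply (c := fun x => encodeBool (L.boolIndicator x))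
        (f := fun _ => QCircuit.sigmaEncode (G := cliffordT) ⟨1, 0, xWordCirc⟩)
        (g := fun _ => QCircuit.sigmaEncode (G := cliffordT) ⟨1, 0, (⟨[]⟩ : QCircuit cliffordT 1)⟩)
        (z := x) h]
      rcases Bool.eq_false_or_eq_true (L.boolIndicator x) with hb | hb <;> simp [hb]
    have hFP := iteFn_mem_FP hc (const_mem_FP (QCircuit.sigmaEncode (G := cliffordT) ⟨1, 0, xWordCirc⟩))
      (const_mem_FP (QCircuit.sigmaEncode (G := cliffordT) ⟨1, 0, (⟨[]⟩ : QCircuit cliffordT 1)⟩))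
    rw [← key] at hFP
    exact hFP
  · -- thresholds `1/2 ± 1/2`
    refine ⟨fun hx => ?_, fun hx => ?_⟩
    · have hb : L.boolIndicator x = true := (L.mem_iff_boolIndicator x).1 hx
      simp only [hb, ↓reduceIte, Polynomial.eval_one, Nat.cast_one]
      rw [oneCleanQubitAcceptProb_xWordCirc]
      norm_num
    · have hb : L.boolIndicator x = false := (L.notMem_iff_boolIndicator x).1 hx
      simp only [hb, Bool.false_eq_true, ↓reduceIte, Polynomial.eval_one, Nat.cast_one]
      rw [oneCleanQubitAcceptProb_nil]
      norm_num

end Literature.Computability.QuantumComplexity
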